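import Summits.AtomisticToContinuum.HydrodynamicLimit.Theorems.InformationPercolationEnginePercolationClosesChaosForecastRobustDefs
import Summits.AtomisticToContinuum.HydrodynamicLimit.Theorems.InformationPercolationEnginePercolationClosesChaosForecastAlgebra
import HarnessLib

/-!
# Forecast transfer of the line `equilibrium-forecast-chain-rule` (crux `InformationPercolationEngine.PercolationClosesChaos`,
stmt-AtomisticToContinuum-15178) — piece H5_W: the WEIGHTED per-unit split `ForecastSplitW` from `JngSpec` (skeleton v9, worker W2)

Support file (`--supports stmt-AtomisticToContinuum-15178`) proving the registered helper headline
`forecastSplitW_of : JngSpec → ForecastSplitW` — hypothesis H5_W of the weighted architecture `kineticCellChaosLG_of_w`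
(`…ForecastTransferArchW`). With `Ĝ = gForecast b c σ N Φ`, `V = Ĝ bW'` (`bW' = badWeight Ψ η' T`), a law `μ` on phase space and a
unit-indexed factor `J` with values in `{0, 1}`:

* `ae_gForecast_mul_eq` — the PULL-IN: for `J (k, q)` measurable for `σ(seqHist k q)` and bounded, `Ĝ (J·X) (k, q) = J (k, q) · Ĝ X (k, q)`
  `G_N`-a.e. (Mathlib's `condExp_mul_of_stronglyMeasurable_left`);
* `unitMean_gForecast_le_splitW` — conjunct (1) for every probability law `μ ≪ G_N`: if `J (k, q) = 0` forces, on the good set,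
  "cell `q` empty at `kΔ` or binned-good", then
  `m(Ĝ X) ≤ m(Ĝ (J·X)) + δ · h³ · #cellBox h + T · m(𝟙{GoodUnitB ∧ δ < V}) + m(Ĝ R)`: `μ`-a.e. per unit
  `Ĝ X = J·Ĝ X + (1 − J)·Ĝ X`, `J·Ĝ X = Ĝ(J·X)` (pull-in), `Ĝ X ≤ V + Ĝ R` (`condExp_mono` / `condExp_add`, `G_N(goodᶜ) = 0`), and on
  `{J = 0}` either `V = 0` (empty cell, `ae_gForecast_badWeight_eq_zero_of_empty`) or `V ≤ δ + T 𝟙{δ < V}` (`0 ≤ V ≤ T` a.e.);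
* `unitMean_mul_le_of_sandwich` — conjunct (2) for every finite law `μ ≪ liouville`: `m(J·X) ≤ m(J·min(ownedCount, T)) + m(R)`
  (`X ≤ bW' + R` on the good set, `bW' ≤ min(ownedCount, T)`, `0 ≤ J ≤ 1`);
* `forecastSplitW_of` — `μ = LG = localGibbsLaw σ a₀ u₀ θ₀ N Φ` (a probability measure `≪ G_N` by the finite entropy budget
  `exists_lgTransferConst`, as in `forecastAlgebra_holds`) and `J = Jng b ϑs ϑ φs c σ N Φ` (an indicator factoring through `seqHist k q`,
  whose value on the good set `JngSpec` supplies).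
-/

noncomputable section

open MeasureTheory Set Filter Topology
open scoped ENNReal BigOperators Classical
open Literature.Analysis.FluidPDE Literature.MathematicalPhysics.KineticTheory
open Literature.MathematicalPhysics.KineticTheory.VelocityBlindPlacement

namespace Summit.AtomisticToContinuum.HydrodynamicLimit.Theorems.EquilibriumForecastLine

variable {σ : ℝ} {N : ℕ}

/-! ## Measurability of the binned good-unit event -/

/-- Replacing every velocity by the centre of its bin is a Borel map of phase space (positions untouched; the new velocity is a
function of the velocity bin, a measurable map into the countable discrete `Cell`). [folklore] -/
theorem splitW_measurable_binConfig (b : ℝ) : Measurable (binConfig (N := N) b) := by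
  refine measurable_pi_lambda _ fun i => ?_
  show Measurable fun w : Phase N => ((w i).1, binCentre b (velBin b (w i).2))
  exact (measurable_pi_apply i).fst.prodMk
    ((measurable_of_countable (binCentre b)).comp ((measurable_velBin b).comp (measurable_pi_apply i).snd))

/-- The binned good-unit event `GoodUnitB b … (Φ.flow t z) q` is a Borel event of the initial datum. [folklore] -/
theorem splitW_measurableSet_goodUnitB (Φ : Flow σ N) (b ϑs ϑ φs c t : ℝ) (q : Cell) :
    MeasurableSet {z : Phase N | GoodUnitB b ϑs ϑ φs c σ N (Φ.flow t z) q} :=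
  (measurableSet_goodUnit ϑs ϑ φs c σ q).preimage ((splitW_measurable_binConfig b).comp (Φ.measurable_flow t))

/-! ## The pull-in -/

/-- **The pull-in of a revealed bounded factor.** If `J (k, q)` is `σ(seqHist k q)`-measurable with `|J| ≤ 1` and `X (k, q)` is Borel
with `|X| ≤ T`, then `Ĝ (J·X) (k, q) = J (k, q) · Ĝ X (k, q)` `G_N`-a.e. (`σ ≤ 1/2`, so that `G_N` is a probability measure;
Mathlib's `condExp_mul_of_stronglyMeasurable_left`). [folklore] -/
theorem ae_gForecast_mul_eq (Φ : Flow σ N) (hσ2 : σ ≤ 1 / 2) (b c : ℝ) {J X : ℕ → Cell → Phase N → ℝ} {T : ℝ} (k : ℕ)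
    (q : Cell) (hJm : Measurable[MeasurableSpace.comap (seqHist b c σ N Φ k q) ⊤] (J k q)) (hJ1 : ∀ z, |J k q z| ≤ 1)
    (hXm : Measurable (X k q)) (hX : ∀ z, |X k q z| ≤ T) :
    ∀ᵐ z ∂(eqLaw σ N Φ), gForecast b c σ N Φ (fun k q z => J k q z * X k q z) k q z = J k q z * gForecast b c σ N Φ X k q z := by
  haveI : IsProbabilityMeasure (eqLaw σ N Φ) := isProbabilityMeasure_eqLaw hσ2 N Φ
  have hJm' : Measurable (J k q) := hJm.mono (comap_seqHist_le Φ b c k q) le_rfl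
  have hXi : Integrable (X k q) (eqLaw σ N Φ) := integrable_of_measurable_abs_le _ hXm hX
  have hJX : ∀ z, |(J k q * X k q) z| ≤ 1 * T := fun z => by
    rw [Pi.mul_apply, abs_mul]
    exact mul_le_mul (hJ1 z) (hX z) (abs_nonneg _) zero_le_one
  have hJXi : Integrable (J k q * X k q) (eqLaw σ N Φ) := integrable_of_measurable_abs_le _ (hJm'.mul hXm) hJX
  have h := condExp_mul_of_stronglyMeasurable_left hJm.stronglyMeasurable hJXi hXi
  filter_upwards [h] with z hz
  exact hz

/-! ## Conjunct (1): the weighted split of the mean forecast -/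

/-- **Conjunct (1) of `ForecastSplitW` for a probability law `μ ≪ G_N`.** Let `0 < σ < 1/2`, `Ψ` continuous, `0 < T`, `0 < c`, `0 < δ`,
`X, R` revealed, box-supported, `[0, T]`-valued with `X ≤ bW' + R` on the good set (`bW' = badWeight Ψ η' T`), and `J` a `{0,1}`-valued
family with `J (k, q)` `σ(seqHist k q)`-measurable and such that, on the good set, `J (k, q) z = 0` and "cell `q` occupied at `kΔ`" force
`GoodUnitB b ϑs ϑ φs … q`. Then, with `Ĝ = gForecast b c σ N Φ`, `V = Ĝ bW'`,
`m(Ĝ X) ≤ m(Ĝ (J·X)) + δ · h³ · #cellBox h + T · m(𝟙{GoodUnitB ∧ δ < V}) + m(Ĝ R)`: `μ`-a.e. per unit of the box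
`Ĝ X ≤ Ĝ(J·X) + δ + T 𝟙{GoodUnitB ∧ δ < V} + Ĝ R` (pull-in, `Ĝ X ≤ V + Ĝ R`, `0 ≤ V ≤ T`, `V = 0` on empty cells, `0 ≤ Ĝ R`, all
`G_N`-a.e. and transported by `μ ≪ G_N`), then summed over the box and integrated. [folklore] -/
theorem unitMean_gForecast_le_splitW (Φ : Flow σ N) (μ : Measure (Phase N)) [IsProbabilityMeasure μ] (hμ : μ ≪ eqLaw σ N Φ)
    (hσ : 0 < σ) (hσ2 : σ < 2⁻¹) {Ψ : V3 × V3 × V3 → ℝ} (hΨ : Continuous Ψ) (η' : ℝ) {T c δ : ℝ} (b τ ϑs ϑ φs : ℝ)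
    (hT : 0 < T) (hc : 0 < c) (hδ : 0 < δ) {X R J : ℕ → Cell → Phase N → ℝ}
    (hXb : ∀ k q z, 0 ≤ X k q z ∧ X k q z ≤ T) (hRb : ∀ k q z, 0 ≤ R k q z ∧ R k q z ≤ T)
    (hX0 : ∀ k, ∀ q ∉ cellBox (c * meanFreePath σ N), X k q = fun _ => 0)
    (hR0 : ∀ k, ∀ q ∉ cellBox (c * meanFreePath σ N), R k q = fun _ => 0)
    (hXa : ∀ k q, q ∈ cellBox (c * meanFreePath σ N) → ∀ z z',
      seqHistLE b c σ N Φ k q z = seqHistLE b c σ N Φ k q z' → X k q z = X k q z')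
    (hRa : ∀ k q, q ∈ cellBox (c * meanFreePath σ N) → ∀ z z',
      seqHistLE b c σ N Φ k q z = seqHistLE b c σ N Φ k q z' → R k q z = R k q z')
    (hsand : ∀ k q, ∀ z ∈ Φ.good, X k q z ≤ badWeight Ψ η' T c σ N Φ k q z + R k q z)
    (hJ01 : ∀ k q z, J k q z = 0 ∨ J k q z = 1)
    (hJm : ∀ k q, Measurable[MeasurableSpace.comap (seqHist b c σ N Φ k q) ⊤] (J k q))
    (hJspec : ∀ k q, ∀ z ∈ Φ.good, J k q z = 0 → (pop c σ N (Φ.flow ((k : ℝ) * stepLen c σ N) z) q).Nonempty →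
      GoodUnitB b ϑs ϑ φs c σ N (Φ.flow ((k : ℝ) * stepLen c σ N) z) q) :
    unitMean c σ N τ μ (gForecast b c σ N Φ X) ≤
      unitMean c σ N τ μ (gForecast b c σ N Φ fun k q z => J k q z * X k q z) +
        δ * ((c * meanFreePath σ N) ^ 3 * (cellBox (c * meanFreePath σ N)).card) +
        T * unitMean c σ N τ μ (fun k q z =>
          if GoodUnitB b ϑs ϑ φs c σ N (Φ.flow ((k : ℝ) * stepLen c σ N) z) q ∧
              δ < gForecast b c σ N Φ (badWeight Ψ η' T c σ N Φ) k q z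
          then 1 else 0) +
        unitMean c σ N τ μ (gForecast b c σ N Φ R) := by
  set G := eqLaw σ N Φ with hG
  set V : ℕ → Cell → Phase N → ℝ := gForecast b c σ N Φ (badWeight Ψ η' T c σ N Φ) with hV
  set W : ℕ → Cell → Phase N → ℝ := gForecast b c σ N Φ (fun k q z => J k q z * X k q z) with hW
  set I₁ : ℕ → Cell → Phase N → ℝ := fun k q z =>
    if GoodUnitB b ϑs ϑ φs c σ N (Φ.flow ((k : ℝ) * stepLen c σ N) z) q ∧ δ < V k q z then 1 else 0 with hI₁
  set B : Cell → ℝ := fun q => if q ∈ cellBox (c * meanFreePath σ N) then δ else 0 with hB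
  have hh : 0 < c * meanFreePath σ N := mul_pos hc (meanFreePath_pos hσ N)
  have hσ2' : σ ≤ 1 / 2 := hσ2.le.trans (by norm_num)
  haveI : IsProbabilityMeasure G := isProbabilityMeasure_eqLaw hσ2' N Φ
  have hGac : G ≪ liouville G3 (N + 1) (hsDiameter σ N) := eqLaw_absolutelyContinuous σ N Φ
  have hμL : μ ≪ liouville G3 (N + 1) (hsDiameter σ N) := hμ.trans hGac
  -- bounds, measurability and integrability of the unit families
  have hXabs : ∀ k q z, |X k q z| ≤ T := fun k q z => abs_le_of_unitBounds (hXb k q z)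
  have hRabs : ∀ k q z, |R k q z| ≤ T := fun k q z => abs_le_of_unitBounds (hRb k q z)
  have hBabs : ∀ k q z, |badWeight Ψ η' T c σ N Φ k q z| ≤ T := fun k q z => abs_badWeight_le_level hc.le hσ Ψ η' hT.le Φ k q z
  have hJb : ∀ k q z, 0 ≤ J k q z ∧ J k q z ≤ 1 := fun k q z => by
    rcases hJ01 k q z with h | h <;> rw [h] <;> norm_num
  have hJ1 : ∀ k q z, |J k q z| ≤ 1 := fun k q z => abs_le_of_unitBounds (hJb k q z)
  have hJXb : ∀ k q z, 0 ≤ J k q z * X k q z ∧ J k q z * X k q z ≤ T := fun k q z =>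
    ⟨mul_nonneg (hJb k q z).1 (hXb k q z).1, (mul_le_of_le_one_left (hXb k q z).1 (hJb k q z).2).trans (hXb k q z).2⟩
  have hJXabs : ∀ k q z, |J k q z * X k q z| ≤ T := fun k q z => abs_le_of_unitBounds (hJXb k q z)
  have hXm : ∀ k q, Measurable (X k q) := fun k q => measurable_unitFamily Φ b c hX0 hXa k q
  have hXiG : ∀ k q, Integrable (X k q) G := fun k q => integrable_of_measurable_abs_le G (hXm k q) (hXabs k q)
  have hRiG : ∀ k q, Integrable (R k q) G := fun k q =>
    integrable_of_measurable_abs_le G (measurable_unitFamily Φ b c hR0 hRa k q) (hRabs k q)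
  have hBiG : ∀ k q, Integrable (badWeight Ψ η' T c σ N Φ k q) G := fun k q =>
    integrable_badWeight_of_ac Φ G hGac hσ hσ2 hΨ η' hT.le hc k q
  -- per unit, `G_N`-a.e.: the sandwich of the forecasts, the pull-in, the range of `V`, the empty-cell pull-out, `0 ≤ Ĝ R`
  have hunit : ∀ k q, ∀ᵐ z ∂G, gForecast b c σ N Φ X k q z ≤ V k q z + gForecast b c σ N Φ R k q z := by
    intro k q
    have hle : X k q ≤ᵐ[G] (badWeight Ψ η' T c σ N Φ k q + R k q) := by
      filter_upwards [ae_mem_good_of_ac Φ hGac] with z hz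
      exact hsand k q z hz
    have h1 := condExp_mono (m := MeasurableSpace.comap (seqHist b c σ N Φ k q) ⊤) (hXiG k q) ((hBiG k q).add (hRiG k q)) hle
    have h2 := condExp_add (hBiG k q) (hRiG k q) (MeasurableSpace.comap (seqHist b c σ N Φ k q) ⊤)
    filter_upwards [h1, h2] with z hz1 hz2
    exact hz1.trans_eq hz2
  have hpull : ∀ k q, ∀ᵐ z ∂G, W k q z = J k q z * gForecast b c σ N Φ X k q z := fun k q =>
    ae_gForecast_mul_eq Φ hσ2' b c k q (hJm k q) (hJ1 k q) (hXm k q) (hXabs k q)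
  have hVnn : ∀ k q, ∀ᵐ z ∂G, 0 ≤ V k q z := fun k q =>
    ae_gForecast_nonneg Φ b c fun z => badWeight_nonneg hc.le hσ Ψ η' hT.le Φ k q z
  have hVle : ∀ k q, ∀ᵐ z ∂G, V k q z ≤ T := fun k q =>
    (ae_abs_gForecast_le Φ b c k q (hBabs k q)).mono fun z hz => (le_abs_self _).trans hz
  have hVemp : ∀ (k : ℕ) (q : Cell), ∀ᵐ z ∂G, ¬ (pop c σ N (Φ.flow ((k : ℝ) * stepLen c σ N) z) q).Nonempty →
      V k q z = 0 :=
    fun k q => ae_gForecast_badWeight_eq_zero_of_empty Φ hσ hσ2 hΨ η' b hT.le hc k q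
  have hRnn : ∀ k q, ∀ᵐ z ∂G, 0 ≤ gForecast b c σ N Φ R k q z := fun k q =>
    ae_gForecast_nonneg Φ b c fun z => (hRb k q z).1
  have hall : ∀ᵐ z ∂μ, ∀ k q,
      (gForecast b c σ N Φ X k q z ≤ V k q z + gForecast b c σ N Φ R k q z ∧ W k q z = J k q z * gForecast b c σ N Φ X k q z) ∧
      ((0 ≤ V k q z ∧ V k q z ≤ T) ∧ (¬ (pop c σ N (Φ.flow ((k : ℝ) * stepLen c σ N) z) q).Nonempty → V k q z = 0)) ∧
      0 ≤ gForecast b c σ N Φ R k q z :=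
    ae_all_iff.2 fun k => ae_all_iff.2 fun q =>
      hμ.ae_le (((hunit k q).and (hpull k q)).and ((((hVnn k q).and (hVle k q)).and (hVemp k q)).and (hRnn k q)))
  -- box support
  have hGX0 : ∀ (z : Phase N) (k : ℕ), ∀ q ∉ cellBox (c * meanFreePath σ N), gForecast b c σ N Φ X k q z = 0 :=
    fun z k q hq => gForecast_apply_eq_zero_of_forall Φ b c (fun z => by rw [hX0 k q hq]) z
  have hGR0 : ∀ (z : Phase N) (k : ℕ), ∀ q ∉ cellBox (c * meanFreePath σ N), gForecast b c σ N Φ R k q z = 0 :=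
    fun z k q hq => gForecast_apply_eq_zero_of_forall Φ b c (fun z => by rw [hR0 k q hq]) z
  have hW0 : ∀ (z : Phase N) (k : ℕ), ∀ q ∉ cellBox (c * meanFreePath σ N), W k q z = 0 :=
    fun z k q hq => gForecast_apply_eq_zero_of_forall Φ b c (F := fun k q z => J k q z * X k q z)
      (fun z => by simp only [hX0 k q hq, mul_zero]) z
  have hV0 : ∀ (z : Phase N) (k : ℕ), ∀ q ∉ cellBox (c * meanFreePath σ N), V k q z = 0 :=
    fun z k q hq => gForecast_apply_eq_zero_of_forall Φ b c (fun z => badWeight_eq_zero_of_not_mem hh Ψ η' hT.le Φ k hq z) z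
  have hI₁0 : ∀ (z : Phase N) (k : ℕ), ∀ q ∉ cellBox (c * meanFreePath σ N), I₁ k q z = 0 := by
    intro z k q hq
    simp only [hI₁]
    rw [if_neg]
    rintro ⟨-, hlt⟩
    rw [hV0 z k q hq] at hlt
    exact lt_irrefl _ (hδ.trans hlt)
  have hB0 : ∀ (_z : Phase N) (_k : ℕ), ∀ q ∉ cellBox (c * meanFreePath σ N), B q = 0 := fun _ _ q hq => if_neg hq
  have hTI0 : ∀ (z : Phase N) (k : ℕ), ∀ q ∉ cellBox (c * meanFreePath σ N), T * I₁ k q z = 0 := fun z k q hq => by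
    rw [hI₁0 z k q hq, mul_zero]
  have hS10 : ∀ (z : Phase N) (k : ℕ), ∀ q ∉ cellBox (c * meanFreePath σ N), W k q z + B q = 0 := fun z k q hq => by
    rw [hW0 z k q hq, hB0 z k q hq, add_zero]
  have hS20 : ∀ (z : Phase N) (k : ℕ), ∀ q ∉ cellBox (c * meanFreePath σ N), W k q z + B q + T * I₁ k q z = 0 :=
    fun z k q hq => by rw [hS10 z k q hq, hTI0 z k q hq, add_zero]
  have hS30 : ∀ (z : Phase N) (k : ℕ), ∀ q ∉ cellBox (c * meanFreePath σ N),
      W k q z + B q + T * I₁ k q z + gForecast b c σ N Φ R k q z = 0 :=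
    fun z k q hq => by rw [hS20 z k q hq, hGR0 z k q hq, add_zero]
  -- the pointwise split, `μ`-a.e.
  have hpt : ∀ᵐ z ∂μ, ∀ k q, gForecast b c σ N Φ X k q z ≤ W k q z + B q + T * I₁ k q z + gForecast b c σ N Φ R k q z := by
    filter_upwards [hall, ae_mem_good_of_ac Φ hμL] with z hz hzg k q
    obtain ⟨⟨hle, hw⟩, ⟨⟨-, hT'⟩, hemp⟩, hr⟩ := hz k q
    have i1 : 0 ≤ I₁ k q z := by simp only [hI₁]; positivity
    have hTi : 0 ≤ T * I₁ k q z := mul_nonneg hT.le i1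
    by_cases hq : q ∈ cellBox (c * meanFreePath σ N)
    · have hBq : B q = δ := if_pos hq
      rw [hBq, hw]
      rcases hJ01 k q z with hj | hj
      · rw [hj, zero_mul, zero_add]
        by_cases hne : (pop c σ N (Φ.flow ((k : ℝ) * stepLen c σ N) z) q).Nonempty
        · have hgood := hJspec k q z hzg hj hne
          by_cases hle' : V k q z ≤ δ
          · linarith
          · have e1 : I₁ k q z = 1 := by simp only [hI₁]; exact if_pos ⟨hgood, not_le.1 hle'⟩
            rw [e1, mul_one]
            linarith [hδ.le]
        · have h0 := hemp hne
          linarith [hδ.le]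
      · rw [hj, one_mul]
        linarith [hδ.le]
    · rw [hGX0 z k q hq, hS30 z k q hq]
  -- integrability under `μ`
  have hiX : Integrable (fun z => unitAvg c σ N τ fun k q => gForecast b c σ N Φ X k q z) μ :=
    integrable_unitAvg_family τ hGX0 fun k q => integrable_gForecast Φ b c hμ k q (hXabs k q)
  have hWi : ∀ k q, Integrable (W k q) μ := fun k q => integrable_gForecast Φ b c hμ k q (hJXabs k q)
  have hRi : ∀ k q, Integrable (gForecast b c σ N Φ R k q) μ := fun k q => integrable_gForecast Φ b c hμ k q (hRabs k q)
  have hI₁m : ∀ (k : ℕ) (q : Cell), MeasurableSet {z : Phase N |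
      GoodUnitB b ϑs ϑ φs c σ N (Φ.flow ((k : ℝ) * stepLen c σ N) z) q ∧ δ < V k q z} := fun k q =>
    (splitW_measurableSet_goodUnitB Φ b ϑs ϑ φs c _ q).inter
      (measurableSet_lt measurable_const (measurable_gForecast Φ b c _ k q))
  have hI₁i : ∀ k q, Integrable (I₁ k q) μ := fun k q => integrable_unitIndicator μ (hI₁m k q)
  have hWi' : Integrable (fun z => unitAvg c σ N τ fun k q => W k q z) μ := integrable_unitAvg_family τ hW0 hWi
  have hBi' : Integrable (fun z => unitAvg c σ N τ fun k q => B q) μ :=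
    integrable_unitAvg_family τ (F := fun _ q _ => B q) hB0 fun k q => integrable_const _
  have hTIi' : Integrable (fun z => unitAvg c σ N τ fun k q => T * I₁ k q z) μ :=
    integrable_unitAvg_family τ hTI0 fun k q => (hI₁i k q).const_mul T
  have hRi' : Integrable (fun z => unitAvg c σ N τ fun k q => gForecast b c σ N Φ R k q z) μ :=
    integrable_unitAvg_family τ hGR0 hRi
  have hS1i : Integrable (fun z => unitAvg c σ N τ fun k q => W k q z + B q) μ :=
    integrable_unitAvg_family τ hS10 fun k q => (hWi k q).add (integrable_const _)
  have hS2i : Integrable (fun z => unitAvg c σ N τ fun k q => W k q z + B q + T * I₁ k q z) μ :=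
    integrable_unitAvg_family τ hS20 fun k q => ((hWi k q).add (integrable_const _)).add ((hI₁i k q).const_mul T)
  have hS3i : Integrable (fun z => unitAvg c σ N τ fun k q => W k q z + B q + T * I₁ k q z + gForecast b c σ N Φ R k q z) μ :=
    integrable_unitAvg_family τ hS30 fun k q =>
      (((hWi k q).add (integrable_const _)).add ((hI₁i k q).const_mul T)).add (hRi k q)
  -- the mean of the box constant
  have hBmean : unitMean c σ N τ μ (fun _ q _ => B q) ≤ δ * ((c * meanFreePath σ N) ^ 3 * (cellBox (c * meanFreePath σ N)).card) := by
    show ∫ _z, unitAvg c σ N τ (fun _ q => B q) ∂μ ≤ _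
    rw [integral_const, smul_eq_mul, probReal_univ, one_mul]
    exact unitAvg_boxConst_le τ hδ.le hh.le
  calc unitMean c σ N τ μ (gForecast b c σ N Φ X)
      ≤ unitMean c σ N τ μ (fun k q z => W k q z + B q + T * I₁ k q z + gForecast b c σ N Φ R k q z) :=
        unitMean_mono_ae τ hh.le hGX0 hS30 hiX hS3i hpt
    _ = unitMean c σ N τ μ (fun k q z => W k q z + B q + T * I₁ k q z) + unitMean c σ N τ μ (gForecast b c σ N Φ R) :=
        unitMean_add_family τ hS20 hGR0 hS2i hRi'
    _ = unitMean c σ N τ μ (fun k q z => W k q z + B q) + unitMean c σ N τ μ (fun k q z => T * I₁ k q z) +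
          unitMean c σ N τ μ (gForecast b c σ N Φ R) := by
        rw [unitMean_add_family τ hS10 hTI0 hS1i hTIi']
    _ = unitMean c σ N τ μ W + unitMean c σ N τ μ (fun _ q _ => B q) + T * unitMean c σ N τ μ I₁ +
          unitMean c σ N τ μ (gForecast b c σ N Φ R) := by
        rw [unitMean_add_family τ (F := W) (G := fun _ q _ => B q) hW0 hB0 hWi' hBi', unitMean_const_mul_family]
    _ ≤ unitMean c σ N τ μ W + δ * ((c * meanFreePath σ N) ^ 3 * (cellBox (c * meanFreePath σ N)).card) +
          T * unitMean c σ N τ μ I₁ + unitMean c σ N τ μ (gForecast b c σ N Φ R) := by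
        linarith [hBmean]

/-! ## Conjunct (2): the weighted family is dominated by the weighted count plus the remainder -/

/-- **Conjunct (2) of `ForecastSplitW` for a finite law `μ ≪ liouville`.** Let `0 < σ < 1/2`, `0 ≤ T`, `0 < c`, `X, R` revealed,
box-supported, `[0, T]`-valued with `X ≤ badWeight Ψ η' T + R` on the good set, and `J` a Borel family with values in `[0, 1]`. Then
`m(J·X) ≤ m(J·min(ownedCount, T)) + m(R)`: on the good set (full `μ`-measure) `J·X ≤ J·bW' + J·R ≤ J·min(ownedCount, T) + R` since
`bW' = min(ownedCount, T)·𝟙 ≤ min(ownedCount, T)` (`0 ≤ ownedCount`) and `0 ≤ J ≤ 1`; all three families are box-supported with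
integrable unit averages (`ownedCount` is Liouville-a.e.-measurable, piece M of the docking). [folklore] -/
theorem unitMean_mul_le_of_sandwich (Φ : Flow σ N) (μ : Measure (Phase N)) [IsFiniteMeasure μ]
    (hμ : μ ≪ liouville G3 (N + 1) (hsDiameter σ N)) (hσ : 0 < σ) (hσ2 : σ < 2⁻¹) (Ψ : V3 × V3 × V3 → ℝ) (η' : ℝ) {T c : ℝ}
    (b τ : ℝ) (hT : 0 ≤ T) (hc : 0 < c) {X R J : ℕ → Cell → Phase N → ℝ}
    (hXb : ∀ k q z, 0 ≤ X k q z ∧ X k q z ≤ T) (hRb : ∀ k q z, 0 ≤ R k q z ∧ R k q z ≤ T)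
    (hX0 : ∀ k, ∀ q ∉ cellBox (c * meanFreePath σ N), X k q = fun _ => 0)
    (hR0 : ∀ k, ∀ q ∉ cellBox (c * meanFreePath σ N), R k q = fun _ => 0)
    (hXa : ∀ k q, q ∈ cellBox (c * meanFreePath σ N) → ∀ z z',
      seqHistLE b c σ N Φ k q z = seqHistLE b c σ N Φ k q z' → X k q z = X k q z')
    (hRa : ∀ k q, q ∈ cellBox (c * meanFreePath σ N) → ∀ z z',
      seqHistLE b c σ N Φ k q z = seqHistLE b c σ N Φ k q z' → R k q z = R k q z')
    (hsand : ∀ k q, ∀ z ∈ Φ.good, X k q z ≤ badWeight Ψ η' T c σ N Φ k q z + R k q z)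
    (hJb : ∀ k q z, 0 ≤ J k q z ∧ J k q z ≤ 1) (hJm : ∀ k q, Measurable (J k q)) :
    unitMean c σ N τ μ (fun k q z => J k q z * X k q z) ≤
      unitMean c σ N τ μ (fun k q z => J k q z * min (ownedCount c σ N Φ k q z) T) + unitMean c σ N τ μ R := by
  have hh : 0 < c * meanFreePath σ N := mul_pos hc (meanFreePath_pos hσ N)
  have hmin0 : ∀ k q z, 0 ≤ min (ownedCount c σ N Φ k q z) T := fun k q z => le_min (ownedCount_nonneg hc.le hσ Φ k q z) hT
  -- pointwise on the good set
  have hpt : ∀ᵐ z ∂μ, ∀ k q, J k q z * X k q z ≤ J k q z * min (ownedCount c σ N Φ k q z) T + R k q z := by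
    filter_upwards [ae_mem_good_of_ac Φ hμ] with z hz k q
    have hbw : badWeight Ψ η' T c σ N Φ k q z ≤ min (ownedCount c σ N Φ k q z) T := by
      unfold badWeight
      exact mul_le_of_le_one_right (hmin0 k q z) (by split_ifs <;> norm_num)
    have h1 : J k q z * X k q z ≤ J k q z * (badWeight Ψ η' T c σ N Φ k q z + R k q z) :=
      mul_le_mul_of_nonneg_left (hsand k q z hz) (hJb k q z).1
    have h2 : J k q z * badWeight Ψ η' T c σ N Φ k q z ≤ J k q z * min (ownedCount c σ N Φ k q z) T :=
      mul_le_mul_of_nonneg_left hbw (hJb k q z).1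
    have h3 : J k q z * R k q z ≤ R k q z := mul_le_of_le_one_left (hRb k q z).1 (hJb k q z).2
    linarith [mul_add (J k q z) (badWeight Ψ η' T c σ N Φ k q z) (R k q z)]
  -- box support
  have hJX0 : ∀ (z : Phase N) (k : ℕ), ∀ q ∉ cellBox (c * meanFreePath σ N), J k q z * X k q z = 0 := fun z k q hq => by
    simp only [hX0 k q hq, mul_zero]
  have hJM0 : ∀ (z : Phase N) (k : ℕ), ∀ q ∉ cellBox (c * meanFreePath σ N), J k q z * min (ownedCount c σ N Φ k q z) T = 0 :=
    fun z k q hq => by rw [ownedCount_eq_zero_of_not_mem hh Φ k hq z, min_eq_left hT, mul_zero]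
  have hR0' : ∀ (z : Phase N) (k : ℕ), ∀ q ∉ cellBox (c * meanFreePath σ N), R k q z = 0 := fun z k q hq => by
    rw [hR0 k q hq]
  have hJMR0 : ∀ (z : Phase N) (k : ℕ), ∀ q ∉ cellBox (c * meanFreePath σ N),
      J k q z * min (ownedCount c σ N Φ k q z) T + R k q z = 0 := fun z k q hq => by
    rw [hJM0 z k q hq, hR0' z k q hq, add_zero]
  -- integrability
  have hJXi : ∀ k q, Integrable (fun z => J k q z * X k q z) μ := fun k q =>
    integrable_of_measurable_abs_le μ ((hJm k q).mul (measurable_unitFamily Φ b c hX0 hXa k q)) fun z =>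
      abs_le_of_unitBounds ⟨mul_nonneg (hJb k q z).1 (hXb k q z).1,
        (mul_le_of_le_one_left (hXb k q z).1 (hJb k q z).2).trans (hXb k q z).2⟩
  have hRi : ∀ k q, Integrable (R k q) μ := fun k q =>
    integrable_of_measurable_abs_le μ (measurable_unitFamily Φ b c hR0 hRa k q) fun z => abs_le_of_unitBounds (hRb k q z)
  have hJMi : ∀ k q, Integrable (fun z => J k q z * min (ownedCount c σ N Φ k q z) T) μ := by
    intro k q
    have hae : AEStronglyMeasurable (fun z => J k q z * min (ownedCount c σ N Φ k q z) T) μ :=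
      ((hJm k q).aemeasurable.mul (((aemeasurable_ownedCount Φ hσ hσ2 hc k q).mono_ac hμ).min
        aemeasurable_const)).aestronglyMeasurable
    refine (integrable_const T).mono' hae (ae_of_all _ fun z => ?_)
    rw [Real.norm_eq_abs]
    exact abs_le_of_unitBounds ⟨mul_nonneg (hJb k q z).1 (hmin0 k q z),
      (mul_le_of_le_one_left (hmin0 k q z) (hJb k q z).2).trans (min_le_right _ _)⟩
  have hi1 : Integrable (fun z => unitAvg c σ N τ fun k q => J k q z * X k q z) μ := integrable_unitAvg_family τ hJX0 hJXi
  have hi2 : Integrable (fun z => unitAvg c σ N τ fun k q => J k q z * min (ownedCount c σ N Φ k q z) T) μ :=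
    integrable_unitAvg_family τ hJM0 hJMi
  have hi3 : Integrable (fun z => unitAvg c σ N τ fun k q => R k q z) μ := integrable_unitAvg_family τ hR0' hRi
  have hi23 : Integrable (fun z => unitAvg c σ N τ fun k q => J k q z * min (ownedCount c σ N Φ k q z) T + R k q z) μ :=
    integrable_unitAvg_family τ hJMR0 fun k q => (hJMi k q).add (hRi k q)
  calc unitMean c σ N τ μ (fun k q z => J k q z * X k q z)
      ≤ unitMean c σ N τ μ (fun k q z => J k q z * min (ownedCount c σ N Φ k q z) T + R k q z) :=
        unitMean_mono_ae τ hh.le hJX0 hJMR0 hi1 hi23 hpt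
    _ = unitMean c σ N τ μ (fun k q z => J k q z * min (ownedCount c σ N Φ k q z) T) + unitMean c σ N τ μ R :=
        unitMean_add_family τ hJM0 hR0' hi2 hi3

/-! ## H5_W assembled -/

/-- **Registered helper `forecastSplitW_of` (worker W2 of skeleton v9): `JngSpec → ForecastSplitW`.** With
`LG = localGibbsLaw σ a₀ u₀ θ₀ N Φ` — a probability measure for `σ ≤ 1/2`, `≪ liouville`, and `≪ G_N = eqLaw σ N Φ` because
`KL(LG ‖ G_N) ≤ A(N+1) < ∞` (`exists_lgTransferConst`) — and `J = Jng b ϑs ϑ φs c σ N Φ` (values in `{0, 1}`, factoring through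
`seqHist k q`, and equal on the good set to `𝟙{occupied ∧ ¬GoodUnitB}` by `JngSpec`, so that `J = 0` on an occupied cell forces
`GoodUnitB`): conjunct (1) is `unitMean_gForecast_le_splitW`, conjunct (2) is `unitMean_mul_le_of_sandwich`. [folklore] -/
theorem forecastSplitW_of : JngSpec → ForecastSplitW := by
  intro hJ a₀ θ₀ u₀ ha hθ hu ha0 hθ0 σ hσ hhalf N Φ τ _ Ψ hΨ _ η' T c b _ hT hc _ ϑs ϑ φs δ hδ X R hXb hRb hX0 hR0 hXa hRa hsand
  have hσ2 : σ < 2⁻¹ := hhalf.trans_eq (one_div (2 : ℝ))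
  set μ := localGibbsLaw σ a₀ u₀ θ₀ N Φ with hμdef
  haveI : IsProbabilityMeasure μ := isProbabilityMeasure_localGibbsLaw ha hθ hu ha0 hθ0 hhalf.le N Φ
  have hμL : μ ≪ liouville G3 (N + 1) (hsDiameter σ N) := localGibbsLaw_absolutelyContinuous_liouville σ a₀ u₀ θ₀ N Φ
  obtain ⟨A, -, hLG⟩ := exists_lgTransferConst ha hθ hu ha0 hθ0 hhalf.le
  obtain ⟨hkl, -, -, -, -⟩ := hLG N Φ
  have hkl_ne : InformationTheory.klDiv μ (eqLaw σ N Φ) ≠ ∞ := ne_top_of_le_ne_top ENNReal.ofReal_ne_top hkl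
  have hμG : μ ≪ eqLaw σ N Φ := (InformationTheory.klDiv_ne_top_iff.1 hkl_ne).1
  -- the three properties of the revealed non-good indicator
  have hJ01 : ∀ k q z, Jng b ϑs ϑ φs c σ N Φ k q z = 0 ∨ Jng b ϑs ϑ φs c σ N Φ k q z = 1 :=
    fun k q z => Jng_eq_zero_or_one b ϑs ϑ φs c σ N Φ k q z
  have hJm : ∀ k q, Measurable[MeasurableSpace.comap (seqHist b c σ N Φ k q) ⊤] (Jng b ϑs ϑ φs c σ N Φ k q) :=
    fun k q => measurable_comap_top_of_imp fun z z' h => Jng_eq_of_seqHist_eq h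
  have hJspec : ∀ k q, ∀ z ∈ Φ.good, Jng b ϑs ϑ φs c σ N Φ k q z = 0 →
      (pop c σ N (Φ.flow ((k : ℝ) * stepLen c σ N) z) q).Nonempty →
      GoodUnitB b ϑs ϑ φs c σ N (Φ.flow ((k : ℝ) * stepLen c σ N) z) q := by
    intro k q z hz h0 hne
    rw [hJ Φ b ϑs ϑ φs c k q z hz] at h0
    by_contra hng
    rw [if_pos ⟨hne, hng⟩] at h0
    exact one_ne_zero h0
  have hJb : ∀ k q z, 0 ≤ Jng b ϑs ϑ φs c σ N Φ k q z ∧ Jng b ϑs ϑ φs c σ N Φ k q z ≤ 1 :=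
    fun k q z => Jng_mem_Icc b ϑs ϑ φs c σ N Φ k q z
  refine ⟨unitMean_gForecast_le_splitW Φ μ hμG hσ hσ2 hΨ η' b τ ϑs ϑ φs hT hc hδ hXb hRb hX0 hR0 hXa hRa hsand hJ01 hJm hJspec, ?_⟩
  exact unitMean_mul_le_of_sandwich Φ μ hμL hσ hσ2 Ψ η' b τ hT.le hc hXb hRb hX0 hR0 hXa hRa hsand hJb
    fun k q => (hJm k q).mono (comap_seqHist_le Φ b c k q) le_rfl

end Summit.AtomisticToContinuum.HydrodynamicLimit.Theorems.EquilibriumForecastLine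

end
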